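import Literature.NumberTheory.Sieve.VinogradovExpSumTools
import Literature.NumberTheory.Sieve.RamanujanSum
import HarnessLib

/-!
# Rectangle sums of a Hankel pattern are bounded by the sup of its symbol
# (stub `stub_rectangleFourier` of the crux `HankelLift.HankelDiscrepancy`, stmt-QuantumAdvantage-18439)

For `f : ℕ → ℝ`, a shift `s ≥ 1`, and `S, T ⊆ [0, N)`:
`|∑_{x ∈ S} ∑_{y ∈ T} f(x+y+s)| ≤ B · √(|S|·|T|)` whenever `‖∑_{1 ≤ m ≤ 2N+s} f(m) e(mθ)‖ ≤ B` for
all `θ` (it is only used at `θ = k/(2N+s)`).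

Proof (discrete Fourier analysis on `ℤ/M`, `M = 2N+s`; the Babai–Nisan–Szegedy / Chung–Tetali
"character of a sum" move, Lindsey-lemma shape): with `F(θ) = ∑_{m ≤ M} f(m) e(mθ)`,
`σ(k) = ∑_{x∈S} e(−xk/M)`, `τ(k) = ∑_{y∈T} e(−(y+s)k/M)`, orthogonality on `ℤ/M` and
`1 ≤ x+y+s < M` (no wrap-around) give `M · ∑_{S×T} f(x+y+s) = ∑_{k mod M} F(k/M) σ(k) τ(k)`; then
`|·| ≤ B ∑_k |σ(k)||τ(k)| ≤ B √(∑|σ|²) √(∑|τ|²) = B · M · √(|S||T|)` by Cauchy–Schwarz and Parseval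
(`∑_k |σ(k)|² = M|S|`, the elements of `S` being distinct mod `M`).
[cite: AroraBarak2009, Lemma 13.15 (Lindsey's lemma)]
-/

set_option linter.dupNamespace false -- D-0017: single-problem summit ⇒ `QuantumAdvantage.QuantumAdvantage` by design

noncomputable section

namespace Summit.QuantumAdvantage.QuantumAdvantage.Theorems.HankelLift

open Finset Real
open scoped FourierTransform
open Literature.NumberTheory.Sieve.Vinogradov (afExpSum)
open Literature.NumberTheory.Sieve.RamanujanSum (sum_range_fourierChar_div)

/-- Orthogonality on `ℤ/M` as a Kronecker delta: for an integer `h` with `|h| < M`,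
`∑_{k mod M} e(kh/M) = M·[h = 0]`. [folklore] -/
theorem sum_range_fourierChar_div_eq_ite {M : ℕ} (hM : M ≠ 0) {h : ℤ} (hh : |h| < M) :
    ∑ k ∈ range M, (𝐞 ((k : ℝ) * h / M) : ℂ) = if h = 0 then (M : ℂ) else 0 := by
  rw [sum_range_fourierChar_div hM h]
  by_cases h0 : h = 0
  · simp [h0]
  · rw [if_neg (fun hdvd => h0 (Int.eq_zero_of_abs_lt_dvd hdvd hh)), if_neg h0]

/-- **Parseval on `ℤ/M` for a set of frequencies distinct mod `M`**: if `g` is injective on `T`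
with values in `[0, M)`, then `∑_{k mod M} ‖∑_{y ∈ T} e(−g(y)k/M)‖² = M·|T|`. [folklore] -/
theorem sum_range_norm_sq_expSum_eq {ι : Type*} (T : Finset ι) (g : ι → ℕ) {M : ℕ}
    (hg : ∀ y ∈ T, g y < M) (hinj : ∀ y ∈ T, ∀ y' ∈ T, g y = g y' → y = y') :
    ∑ k ∈ range M, ‖∑ y ∈ T, (𝐞 (-((g y : ℝ) * k / M)) : ℂ)‖ ^ 2 = (M : ℝ) * T.card := by
  rcases Nat.eq_zero_or_pos M with hM0 | hMpos
  · subst hM0; simp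
  have hM : M ≠ 0 := hMpos.ne'
  have key : ∀ k : ℕ, ((‖∑ y ∈ T, (𝐞 (-((g y : ℝ) * k / M)) : ℂ)‖ ^ 2 : ℝ) : ℂ) =
      ∑ y ∈ T, ∑ y' ∈ T, (𝐞 ((k : ℝ) * (((g y' : ℤ) - g y : ℤ) : ℝ) / M) : ℂ) := by
    intro k
    rw [← Complex.normSq_eq_norm_sq, ← Complex.mul_conj, map_sum, Finset.sum_mul_sum]
    refine Finset.sum_congr rfl fun y _ => Finset.sum_congr rfl fun y' _ => ?_
    rw [← Circle.coe_inv_eq_conj, ← AddChar.map_neg_eq_inv, ← Circle.coe_mul,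
      ← AddChar.map_add_eq_mul]
    congr 2
    push_cast
    ring
  have hinner : ∀ y ∈ T, ∑ k ∈ range M, ∑ y' ∈ T,
      (𝐞 ((k : ℝ) * (((g y' : ℤ) - g y : ℤ) : ℝ) / M) : ℂ) = (M : ℂ) := by
    intro y hy
    rw [Finset.sum_comm]
    have horth : ∀ y' ∈ T, ∑ k ∈ range M, (𝐞 ((k : ℝ) * (((g y' : ℤ) - g y : ℤ) : ℝ) / M) : ℂ) =
        if ((g y' : ℤ) - g y : ℤ) = 0 then (M : ℂ) else 0 := by
      intro y' hy'
      refine sum_range_fourierChar_div_eq_ite hM ?_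
      have h1 := hg y hy
      have h2 := hg y' hy'
      rw [abs_lt]
      constructor <;> omega
    rw [Finset.sum_congr rfl horth, Finset.sum_eq_single_of_mem y hy]
    · simp
    · intro y' hy' hne
      rw [if_neg]
      intro h0
      exact hne (hinj y' hy' y hy (by omega))
  have hC : ((∑ k ∈ range M, ‖∑ y ∈ T, (𝐞 (-((g y : ℝ) * k / M)) : ℂ)‖ ^ 2 : ℝ) : ℂ) =
      (((M : ℝ) * T.card : ℝ) : ℂ) := by
    rw [Complex.ofReal_sum, Finset.sum_congr rfl fun k _ => key k, Finset.sum_comm,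
      Finset.sum_congr rfl hinner, Finset.sum_const, nsmul_eq_mul]
    push_cast
    ring
  exact_mod_cast hC

/-- **Rectangle sums from the symbol** (`stub_rectangleFourier` of the birth skeleton of
`HankelLift.HankelDiscrepancy`): for `f : ℕ → ℝ`, a shift `s ≥ 1` and `S, T ⊆ [0, N)`,
`|∑_{x ∈ S} ∑_{y ∈ T} f(x+y+s)| ≤ B·√(|S|·|T|)` whenever `‖∑_{1 ≤ m ≤ 2N+s} f(m) e(mθ)‖ ≤ B` for
all `θ`.  Discrete Fourier expansion on `ℤ/(2N+s)` (no wrap-around since `1 ≤ x+y+s < 2N+s`),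
Cauchy–Schwarz and Parseval. [cite: AroraBarak2009, Lemma 13.15 (Lindsey's lemma)] -/
theorem rectangle_sum_le_of_symbol_bound (N s : ℕ) (hs : 1 ≤ s) (f : ℕ → ℝ) (B : ℝ)
    (hB : ∀ θ : ℝ, ‖afExpSum f (2 * N + s) θ‖ ≤ B) (S T : Finset (Fin N)) :
    |∑ x ∈ S, ∑ y ∈ T, f (x.val + y.val + s)| ≤ B * Real.sqrt ((S.card : ℝ) * (T.card : ℝ)) := by
  set M : ℕ := 2 * N + s with hMdef
  have hM0 : M ≠ 0 := by omega
  have hMpos : (0 : ℝ) < M := by positivity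
  have hB0 : 0 ≤ B := (norm_nonneg _).trans (hB 0)
  -- the discrete Fourier coefficients of `S` and of the shifted `T`
  set σ : ℕ → ℂ := fun k => ∑ x ∈ S, (𝐞 (-((x.val : ℝ) * k / M)) : ℂ) with hσ
  set τ : ℕ → ℂ := fun k => ∑ y ∈ T, (𝐞 (-(((y.val + s : ℕ) : ℝ) * k / M)) : ℂ) with hτ
  -- expansion of each summand of `∑_k F(k/M) σ(k) τ(k)`
  have hk : ∀ k : ℕ, afExpSum f M ((k : ℝ) / M) * (σ k * τ k) =
      ∑ m ∈ Icc 1 M, ∑ p ∈ S ×ˢ T, (f m : ℂ) *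
        (𝐞 ((k : ℝ) * (((m : ℤ) - (p.1.val + p.2.val + s : ℕ) : ℤ) : ℝ) / M) : ℂ) := by
    intro k
    simp only [hσ, hτ, afExpSum]
    rw [Finset.sum_mul_sum, ← Finset.sum_product', Finset.sum_mul_sum]
    refine Finset.sum_congr rfl fun m _ => Finset.sum_congr rfl fun p _ => ?_
    rw [mul_assoc, ← Circle.coe_mul, ← Circle.coe_mul, ← AddChar.map_add_eq_mul,
      ← AddChar.map_add_eq_mul]
    congr 3
    push_cast
    ring
  -- the identity `∑_k F(k/M) σ(k) τ(k) = M · ∑_{S×T} f(x+y+s)`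
  have hident : ∑ k ∈ range M, afExpSum f M ((k : ℝ) / M) * (σ k * τ k) =
      (M : ℂ) * ∑ x ∈ S, ∑ y ∈ T, (f (x.val + y.val + s) : ℂ) := by
    have hR : (M : ℂ) * ∑ x ∈ S, ∑ y ∈ T, (f (x.val + y.val + s) : ℂ) =
        ∑ p ∈ S ×ˢ T, (M : ℂ) * (f (p.1.val + p.2.val + s) : ℂ) := by
      rw [Finset.sum_product, Finset.mul_sum]
      refine Finset.sum_congr rfl fun x _ => ?_
      rw [Finset.mul_sum]
    simp_rw [hk]
    rw [Finset.sum_comm]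
    refine (Finset.sum_congr rfl fun m _ => Finset.sum_comm).trans ?_
    rw [Finset.sum_comm, hR]
    refine Finset.sum_congr rfl fun p hp => ?_
    obtain ⟨hx, hy⟩ := Finset.mem_product.mp hp
    have hx' := p.1.isLt
    have hy' := p.2.isLt
    have horth : ∀ m ∈ Icc 1 M, ∑ k ∈ range M, (f m : ℂ) *
        (𝐞 ((k : ℝ) * (((m : ℤ) - (p.1.val + p.2.val + s : ℕ) : ℤ) : ℝ) / M) : ℂ) =
        (f m : ℂ) * (if ((m : ℤ) - (p.1.val + p.2.val + s : ℕ) : ℤ) = 0 then (M : ℂ) else 0) := by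
      intro m hm
      rw [← Finset.mul_sum, sum_range_fourierChar_div_eq_ite hM0]
      obtain ⟨hm1, hmM⟩ := Finset.mem_Icc.mp hm
      rw [abs_lt]
      push_cast
      constructor <;> omega
    rw [Finset.sum_congr rfl horth,
      Finset.sum_eq_single_of_mem (p.1.val + p.2.val + s) (Finset.mem_Icc.mpr ⟨by omega, by omega⟩)]
    · rw [if_pos (by simp), mul_comm]
    · intro m _ hne
      rw [if_neg (by push_cast; omega), mul_zero]
  -- Parseval for `σ` and `τ`
  have hσP : ∑ k ∈ range M, ‖σ k‖ ^ 2 = (M : ℝ) * S.card :=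
    sum_range_norm_sq_expSum_eq S (fun x : Fin N => x.val) (fun x _ => by omega)
      (fun x _ x' _ h => Fin.ext h)
  have hτP : ∑ k ∈ range M, ‖τ k‖ ^ 2 = (M : ℝ) * T.card :=
    sum_range_norm_sq_expSum_eq T (fun y : Fin N => y.val + s) (fun y _ => by omega)
      (fun y _ y' _ h => Fin.ext (by omega))
  -- the bound
  have hbound : ‖∑ k ∈ range M, afExpSum f M ((k : ℝ) / M) * (σ k * τ k)‖ ≤
      B * ((M : ℝ) * Real.sqrt ((S.card : ℝ) * (T.card : ℝ))) := by
    calc ‖∑ k ∈ range M, afExpSum f M ((k : ℝ) / M) * (σ k * τ k)‖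
        ≤ ∑ k ∈ range M, ‖afExpSum f M ((k : ℝ) / M) * (σ k * τ k)‖ := norm_sum_le _ _
      _ ≤ ∑ k ∈ range M, B * (‖σ k‖ * ‖τ k‖) := by
          refine Finset.sum_le_sum fun k _ => ?_
          rw [norm_mul, norm_mul]
          exact mul_le_mul_of_nonneg_right (hB _) (by positivity)
      _ = B * ∑ k ∈ range M, ‖σ k‖ * ‖τ k‖ := by rw [Finset.mul_sum]
      _ ≤ B * (Real.sqrt (∑ k ∈ range M, ‖σ k‖ ^ 2) * Real.sqrt (∑ k ∈ range M, ‖τ k‖ ^ 2)) :=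
          mul_le_mul_of_nonneg_left (Real.sum_mul_le_sqrt_mul_sqrt _ _ _) hB0
      _ = B * ((M : ℝ) * Real.sqrt ((S.card : ℝ) * (T.card : ℝ))) := by
          rw [hσP, hτP, ← Real.sqrt_mul (by positivity),
            show (M : ℝ) * S.card * ((M : ℝ) * T.card) = (M : ℝ) * M * ((S.card : ℝ) * T.card) by
              ring,
            Real.sqrt_mul (by positivity), Real.sqrt_mul_self hMpos.le]
  -- conclusion
  have hnorm : ‖∑ k ∈ range M, afExpSum f M ((k : ℝ) / M) * (σ k * τ k)‖ =
      (M : ℝ) * |∑ x ∈ S, ∑ y ∈ T, f (x.val + y.val + s)| := by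
    rw [hident, norm_mul, Complex.norm_natCast,
      show (∑ x ∈ S, ∑ y ∈ T, (f (x.val + y.val + s) : ℂ)) =
        ((∑ x ∈ S, ∑ y ∈ T, f (x.val + y.val + s) : ℝ) : ℂ) by push_cast; rfl,
      Complex.norm_real, Real.norm_eq_abs]
  rw [hnorm, mul_left_comm] at hbound
  exact le_of_mul_le_mul_left hbound hMpos

/-- **Registered stub `stub_rectangleFourier`** of the birth skeleton
`Cruxes/HankelDiscrepancy/Lines/birth.lean` (crux `HankelLift.HankelDiscrepancy`,
stmt-QuantumAdvantage-18439), verbatim signature, proved by `rectangle_sum_le_of_symbol_bound`.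
[cite: AroraBarak2009, Lemma 13.15 (Lindsey's lemma)] -/
theorem stub_rectangleFourier :
    ∀ (N s : ℕ), 1 ≤ s → ∀ (f : ℕ → ℝ) (B : ℝ),
      (∀ θ : ℝ, ‖afExpSum f (2 * N + s) θ‖ ≤ B) →
      ∀ S T : Finset (Fin N),
        |∑ x ∈ S, ∑ y ∈ T, f (x.val + y.val + s)| ≤ B * Real.sqrt ((S.card : ℝ) * (T.card : ℝ)) :=
  rectangle_sum_le_of_symbol_bound

end Summit.QuantumAdvantage.QuantumAdvantage.Theorems.HankelLift
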